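import Summits.CriticalPhenomena.PercolationContinuityZ3.Theorems.Transplant.SkelFrmFromBChoiceSlotsPx
import HarnessLib

/-!
# U_s execution (RULING D-Us / Us-R6 / Us-R8 / Us-R10, lead g22 2026-08-27; design owner p3 g27): «SkelFrmFromBChoiceSlotsPxF» — **THE (F) COLUMN'S `+ D` FLOOR
# ON THE EXCESS SLOT and THE EXCESS SLOT OF RECORD `exPxF`** (TUPLE Px OF RECORD, revision F: the tuple's fibre slot is `SUS (exPxF D) (mxPx D)`)

builds on p205010 (kernel theorem, internal audit signed; external expert review pending) — nothing in this file uses p205010; NOTHING is claimed about the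
OPEN node U_s `SamePDropOfSkeletonFrmScaled₁`.  Lane `prim-bschramm`, seat `prim-bschramm-p3` gen 27 (design owner); helper file (`--supports
stmt-CriticalPhenomena-4575 --as helper`); DEFINITIONS (two lower-bound floors) + `rfl`/`max` lemmas only.
WHY (hp-8 g57's located item, bus 2026-08-27T00:24Z, confirmed by the design owner): under proxies the (F) wrapper's face-bridge kit is read at the
face-bridge radius `R_bF + D` (`R_bF := Drec.R (Drec.toDataN.scale t (KS.MBF … (cF κ) m) (KS.nBF … (cF κ) m))`), so the (F) top must know
`KS0.r₀0 t Drec m′ (R_bF + D) + 1 ≤ ex` at the raised index `m′` — a floor the U residual `exF2` states WITHOUT `+ D` and «SkelFrmFromBChoiceSlotsPx» `exRD`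
does not carry (its two `+ D` members are the ROOT bridge `r₀0 m (RB0 m + D) + 1` and the long links `r₀0 m (RLD + D) + 3`).  No domination
`R_bF ≤ RB0 / RLD` is available (different parallelogram scales), so the floor is ADDED: §1 `exRDF m D := exRD m D ⊔ (r₀0 m (R_bF(cF κ) m + D) + 1)` with
`exRD_le_exRDF`, `exRDF_floorF`, `exRDF_floors`; §2 the excess slot of record `exPxF D := raiseG (fun m => exQ m (exRDF m D)) 0 D` with `exPxF_at` (rfl) and
`exPx_le_exPxF`.  CONSEQUENCE (design owner's ruling, bus): the node tuple reads `SUS (exPxF D) (mxPx D)`; the (R) and (C) node tops are re-targeted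
(`…_nodeF`, same proofs — they read the excess slot only through lower-bound floors); Geom is slot-generic; the (F) top is typed at `exPxF` from the start.
[cite: KozmaNitzan2024, §4 Theorem 6 (pp. 25–31), Lemma 12 (pp. 23–25)] [this work]
-/

noncomputable section

open scoped Classical

namespace Summit.CriticalPhenomena.PercolationContinuityZ3.Theorems.Transplant

open MeasureTheory Literature.Probability.Percolation Literature.Probability.LatticeModels SimpleGraph KNCells KNLevels
open SkelConc (Consts)
open Skelφ.StepI (DataN DataNS OutNS)

namespace PlanarSkeletonFrmFrom

namespace NegB

open Neg

/-! ## §1 The (F) floor: the face-bridge window at radius `R_bF + D` -/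

/-- **The excess residual of record, revision F**: `exRDF m D := exRD m D ⊔ (KS0.r₀0 t Drec m (R_bF(cF κ, m) + D) + 1)` — «SkelFrmFromBChoiceSlotsPx».`exRD`
together with the FACE-bridge window floor at radius `R_bF + D` (`R_bF := Drec.R (Drec.toDataN.scale t (KS.MBF κ Φ t p Drec (cF κ) m) (KS.nBF κ Φ t p Drec (cF κ) m))`,
the window constant `cF κ` of the U node).  Lower bounds only. [this work] -/
def exRDF (m D : ℕ) : GSlot := fun κ _ _ _ _ _ Φ t p Drec g f =>
  max (exRD m D κ Φ t p Drec g f)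
    (KS0.r₀0 t Drec m (Drec.R (Drec.toDataN.scale t (KS.MBF κ Φ t p Drec (cF κ) m) (KS.nBF κ Φ t p Drec (cF κ) m)) + D) + 1)

/-- `exRD ≤ exRDF` (the old floors survive). [folklore] -/
theorem exRD_le_exRDF (κ : Consts) {V : Type} [DecidableEq V] [Countable V] {G : SimpleGraph V} [G.LocallyFinite] (Φ : PlanarSkeletonFrmFrom G) (t : V)
    (p : unitInterval) (Drec : DataNS V) (m D g f : ℕ) : exRD m D κ Φ t p Drec g f ≤ exRDF m D κ Φ t p Drec g f := le_max_left _ _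

/-- **The (F) floor**: `KS0.r₀0 t Drec m (R_bF + D) + 1 ≤ exRDF m D`. [this work] -/
theorem exRDF_floorF (κ : Consts) {V : Type} [DecidableEq V] [Countable V] {G : SimpleGraph V} [G.LocallyFinite] (Φ : PlanarSkeletonFrmFrom G) (t : V)
    (p : unitInterval) (Drec : DataNS V) (m D g f : ℕ) :
    KS0.r₀0 t Drec m (Drec.R (Drec.toDataN.scale t (KS.MBF κ Φ t p Drec (cF κ) m) (KS.nBF κ Φ t p Drec (cF κ) m)) + D) + 1 ≤ exRDF m D κ Φ t p Drec g f :=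
  le_max_right _ _

/-- `exRDF` dominates the U residual `exR0`, the two `+ D` window floors of `exRD`, and the (F) floor. [folklore] -/
theorem exRDF_floors (κ : Consts) {V : Type} [DecidableEq V] [Countable V] {G : SimpleGraph V} [G.LocallyFinite] (Φ : PlanarSkeletonFrmFrom G) (t : V)
    (p : unitInterval) (Drec : DataNS V) (m D g f : ℕ) {ex : ℕ} (h : exRDF m D κ Φ t p Drec g f ≤ ex) :
    exR0 m κ Φ t p Drec g f ≤ ex ∧ KS0.r₀0 t Drec m (RLD κ Φ t p Drec g f + D) + 3 ≤ ex ∧ KS0.r₀0 t Drec m (KS.RB0 κ Φ t p Drec m + D) + 1 ≤ ex ∧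
      KS0.r₀0 t Drec m (Drec.R (Drec.toDataN.scale t (KS.MBF κ Φ t p Drec (cF κ) m) (KS.nBF κ Φ t p Drec (cF κ) m)) + D) + 1 ≤ ex := by
  obtain ⟨h1, h2, h3⟩ := exRD_floors κ Φ t p Drec m D g f ((exRD_le_exRDF κ Φ t p Drec m D g f).trans h)
  exact ⟨h1, h2, h3, (exRDF_floorF κ Φ t p Drec m D g f).trans h⟩

/-! ## §2 The excess slot of record, revision F -/

/-- **The rim-excess slot of record under proxies, revision F**: `exQ m′ (exRDF m′ D)` at the raised index `m′ := KS.RK t Drec 0 + D`.  THE NODE TUPLE READS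
`SUS (exPxF D) (mxPx D)`. [this work] -/
def exPxF (D : ℕ) : GSlot := raiseG (fun m => exQ m (exRDF m D)) 0 D

section Values

variable (κ : Consts) {V : Type} [DecidableEq V] [Countable V] {G : SimpleGraph V} [G.LocallyFinite] (Φ : PlanarSkeletonFrmFrom G) (t : V) (p : unitInterval)
  (Drec : DataNS V) (D : ℕ)

/-- The excess slot (revision F) at a record (by `rfl`). [folklore] -/
theorem exPxF_at (g f : ℕ) : exPxF D κ Φ t p Drec g f = exQ (KS.RK t Drec 0 + D) (exRDF (KS.RK t Drec 0 + D) D) κ Φ t p Drec g f := rfl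

/-- `exQ m` is monotone in its residual argument (it is `… ⊔ X`). [folklore] -/
theorem exQ_mono_resid (m : ℕ) {X Y : GSlot} (g f : ℕ) (h : X κ Φ t p Drec g f ≤ Y κ Φ t p Drec g f) :
    exQ m X κ Φ t p Drec g f ≤ exQ m Y κ Φ t p Drec g f := by
  unfold exQ
  exact max_le_max le_rfl (max_le_max le_rfl (max_le_max le_rfl (max_le_max le_rfl (max_le_max le_rfl h))))

/-- `exPx D ≤ exPxF D` pointwise (the revision only adds a floor). [folklore] -/
theorem exPx_le_exPxF (g f : ℕ) : exPx D κ Φ t p Drec g f ≤ exPxF D κ Φ t p Drec g f :=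
  exQ_mono_resid κ Φ t p Drec (KS.RK t Drec 0 + D) g f (exRD_le_exRDF κ Φ t p Drec (KS.RK t Drec 0 + D) D g f)

/-- The residual of `exPxF D` dominates its own value's four floors at the raised index (what the column tops read). [folklore] -/
theorem exPxF_floors (g f : ℕ) {ex : ℕ} (h : exPxF D κ Φ t p Drec g f ≤ ex) :
    exR0 (KS.RK t Drec 0 + D) κ Φ t p Drec g f ≤ ex ∧ KS0.r₀0 t Drec (KS.RK t Drec 0 + D) (RLD κ Φ t p Drec g f + D) + 3 ≤ ex ∧
      KS0.r₀0 t Drec (KS.RK t Drec 0 + D) (KS.RB0 κ Φ t p Drec (KS.RK t Drec 0 + D) + D) + 1 ≤ ex ∧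
      KS0.r₀0 t Drec (KS.RK t Drec 0 + D) (Drec.R (Drec.toDataN.scale t (KS.MBF κ Φ t p Drec (cF κ) (KS.RK t Drec 0 + D)) (KS.nBF κ Φ t p Drec (cF κ) (KS.RK t Drec 0 + D))) + D) + 1 ≤ ex :=
  exRDF_floors κ Φ t p Drec (KS.RK t Drec 0 + D) D g f ((le_exQ (KS.RK t Drec 0 + D) (exRDF (KS.RK t Drec 0 + D) D) κ Φ t p Drec g f).2.2.2.2.trans h)

end Values

end NegB

end PlanarSkeletonFrmFrom

end Summit.CriticalPhenomena.PercolationContinuityZ3.Theorems.Transplant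

end
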